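import Summits.AnomalousDissipation.AnomalousDissipation.Theses.TwoAndHalfD
import Literature.Analysis.FluidPDE.PassiveScalarClassicalEnergy
import Literature.Analysis.FluidPDE.ScalarSpectralPoincare
import Literature.Analysis.FluidPDE.PassiveScalarEnergySlice

/-!
# P1 `stub_fixedViscosityEnvelope`: exponential `L²` envelope of a release at fixed diffusivity

Registered tool stub of the line `Sketch` (duhamel-release) for the crux
`Summit.AnomalousDissipation.AnomalousDissipation.Theses.TwoAndHalfD.TwohalfdThesis`
(stmt-AnomalousDissipation-0206); the statement is registered verbatim on the item.

CONTENT. The line's residual witness asks for an integrable `L²` envelope of the releases `φ` of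
a zero-mean pattern `h`, UNIFORM along a family of drifts with diffusivity `ν_j → 0`. This file
records the contrast at FIXED diffusivity `κ > 0`: every classical zero-mean release decays
exponentially, `‖φ(t)‖²_{L²} ≤ e^{-8π²κ(t-s)} ‖h‖²_{L²}` for `t ≥ s`, whatever the
(divergence-free, smooth) drift — so each single `j` has an integrable envelope for free and the
whole content of the witness is uniformity in `j`.

PROOF (general dimension `d`, then the registered `Fin 2` statement as a one-line corollary).
* `scalarL2Sq_mul_le_scalarGradNormSq_of_hasZeroMean` — the Poincaré–Wirtinger inequality on the
  unit torus `T^d = (ℝ/ℤ)^d` for smooth zero-mean scalars, `4π² ‖θ‖² ≤ ‖∇θ‖²` (sharp constant: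
  the first nonzero eigenvalue of `-Δ` is `4π²`, characters `e^{2πik·x}`): the tree's spectral
  form `Torus.scalarVariance_le_toReal_eScalarGradNormSq` (`4π²(∫θ² - (∫θ)²) ≤ ‖∇θ‖²_spec`),
  read for a smooth scalar, whose spectral and classical gradient norms agree
  (`Torus.scalarGradNormSq_eq_toReal_holds`) and are finite
  (`Torus.eScalarGradNormSq_eq_ofReal_integral`).
* `scalarL2Sq_le_exp_mul_of_hasZeroMean` — the Gronwall step along a classical solution on a
  convex time set `S`: zero mean persists (`Torus.IsClassicalScalarTransportOn.hasZeroMean`), the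
  `L²` balance `d/dt ‖θ‖² = -2κ‖∇θ‖²` (`hasDerivWithinAt_scalarL2Sq_holds`) and Poincaré give
  `d/dt ‖θ‖² ≤ -8π²κ‖θ‖²` on `S ∩ [s, ∞)`, so `t ↦ e^{8π²κt}‖θ(t)‖²` has a nonpositive one-sided
  derivative there and is non-increasing (Mathlib `antitoneOn_of_hasDerivWithinAt_nonpos`) —
  verbatim the argument of `IsClassicalNSCoriolisSolutionOn.torus_kineticEnergy_le_mul_exp`.
* `stub_fixedViscosityEnvelope` — `S = [s, ∞)`, `θ = φ`, `φ s = h`.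
Supports stmt-AnomalousDissipation-0206. [folklore]
-/

noncomputable section

-- the summit path `AnomalousDissipation/AnomalousDissipation` duplicates a namespace component
set_option linter.dupNamespace false

namespace Summit.AnomalousDissipation.AnomalousDissipation.Theorems.TwohalfdThesis

open MeasureTheory Set Filter Topology
open scoped ENNReal NNReal InnerProductSpace
open Literature.Analysis.FunctionSpaces Literature.Analysis.FluidPDE

variable {d : Type*} [Fintype d]

/-- **Poincaré–Wirtinger on the unit torus for smooth zero-mean scalars**, classical form:
`4π² ∫ θ² ≤ ∫ ‖∇θ‖²` for smooth `θ : T^d → ℝ` with `∫ θ = 0` (the spectral inequality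
`Torus.scalarVariance_le_toReal_eScalarGradNormSq` with `(∫θ)² = 0`, the spectral gradient norm
of a smooth scalar being its classical one, `Torus.scalarGradNormSq_eq_toReal_holds`, and finite,
`Torus.eScalarGradNormSq_eq_ofReal_integral`). [folklore] -/
theorem scalarL2Sq_mul_le_scalarGradNormSq_of_hasZeroMean {θ : UnitAddTorus d → ℝ}
    (hθ : Torus.IsSmooth θ) (h0 : Torus.HasZeroMean θ) :
    4 * Real.pi ^ 2 * Torus.scalarL2Sq θ ≤ Torus.scalarGradNormSq θ := by
  have hfin : Torus.eScalarGradNormSq θ ≠ ⊤ := by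
    rw [Torus.eScalarGradNormSq_eq_ofReal_integral hθ]
    exact ENNReal.ofReal_ne_top
  have h1 := Torus.scalarVariance_le_toReal_eScalarGradNormSq (hθ.memLp 2) hfin
  have h0' : ∫ x, θ x = 0 := h0
  rw [h0', zero_pow two_ne_zero, sub_zero, ← Torus.scalarGradNormSq_eq_toReal_holds hθ] at h1
  exact h1

variable [DecidableEq d]

/-- **Exponential `L²` decay of zero-mean classical passive scalars at fixed diffusivity**
(general dimension): for a classical solution `θ` of `∂ₜθ + u·∇θ = κΔθ`, `div u = 0`, `κ ≥ 0`,
on a convex time set `S`, with `∫ θ(s) = 0` at some `s ∈ S`, one has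
`‖θ(t)‖²_{L²} ≤ e^{-8π²κ(t-s)} ‖θ(s)‖²_{L²}` for every `t ≥ s` in `S`. Zero mean persists
(`Torus.IsClassicalScalarTransportOn.hasZeroMean`), so Poincaré
(`scalarL2Sq_mul_le_scalarGradNormSq_of_hasZeroMean`) and the `L²` balance
`d/dt ‖θ‖² = -2κ‖∇θ‖²` (`hasDerivWithinAt_scalarL2Sq_holds`) make `t ↦ e^{8π²κt}‖θ(t)‖²`
non-increasing on `S ∩ [s, ∞)` (`antitoneOn_of_hasDerivWithinAt_nonpos`). [folklore] -/
theorem scalarL2Sq_le_exp_mul_of_hasZeroMean {S : Set ℝ} {κ : ℝ}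
    {u : ℝ → UnitAddTorus d → EuclideanSpace ℝ d} {θ : ℝ → UnitAddTorus d → ℝ}
    (hsol : Torus.IsClassicalScalarTransportOn S κ u θ) (hκ : 0 ≤ κ) (hS : Convex ℝ S)
    {s t : ℝ} (hs : s ∈ S) (ht : t ∈ S) (hst : s ≤ t) (h0 : Torus.HasZeroMean (θ s)) :
    Torus.scalarL2Sq (θ t) ≤
      Real.exp (-(8 * Real.pi ^ 2 * κ) * (t - s)) * Torus.scalarL2Sq (θ s) := by
  set c : ℝ := 8 * Real.pi ^ 2 * κ with hc
  set E : ℝ → ℝ := fun τ => Torus.scalarL2Sq (θ τ) with hE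
  -- the forward part `S' = S ∩ [s, ∞)` of the time set, again convex
  set S' : Set ℝ := S ∩ Ici s with hS'def
  have hS' : Convex ℝ S' := hS.inter (convex_Ici s)
  have hsS' : s ∈ S' := ⟨hs, self_mem_Ici⟩
  have htS' : t ∈ S' := ⟨ht, hst⟩
  -- the `L²` balance within `S`, restricted to `S'`
  have hdE : ∀ τ ∈ S', HasDerivWithinAt E (-(2 * κ) * Torus.scalarGradNormSq (θ τ)) S' τ :=
    fun τ hτ =>
      (Torus.IsClassicalScalarTransportOn.hasDerivWithinAt_scalarL2Sq_holds hsol hS hτ.1).mono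
        inter_subset_left
  -- zero mean persists forward in time, hence Poincaré along the solution on `S'`
  have hP : ∀ τ ∈ S', 4 * Real.pi ^ 2 * E τ ≤ Torus.scalarGradNormSq (θ τ) := by
    intro τ hτ
    have hsub : Icc s τ ⊆ S := hS.ordConnected.out hs hτ.1
    have hmean : Torus.HasZeroMean (θ τ) := hsol.hasZeroMean hsub h0 ⟨hτ.2, le_rfl⟩
    exact scalarL2Sq_mul_le_scalarGradNormSq_of_hasZeroMean
      (hsol.smooth_scalar.isSmooth_slice hτ.1) hmean
  -- `g = e^{cτ} E` has nonpositive derivative within `S'`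
  have hdg : ∀ τ ∈ S', HasDerivWithinAt (fun σ => Real.exp (c * σ) * E σ)
      (Real.exp (c * τ) * (c * E τ - 2 * κ * Torus.scalarGradNormSq (θ τ))) S' τ := by
    intro τ hτ
    have h1 : HasDerivAt (fun σ => Real.exp (c * σ)) (Real.exp (c * τ) * c) τ := by
      simpa using ((hasDerivAt_id τ).const_mul c).exp
    refine ((h1.hasDerivWithinAt (s := S')).mul (hdE τ hτ)).congr_deriv ?_
    ring
  have hg0 : ∀ τ ∈ S',
      Real.exp (c * τ) * (c * E τ - 2 * κ * Torus.scalarGradNormSq (θ τ)) ≤ 0 := by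
    intro τ hτ
    refine mul_nonpos_iff.2 (Or.inl ⟨Real.exp_nonneg _, ?_⟩)
    have e1 : c * E τ - 2 * κ * Torus.scalarGradNormSq (θ τ) =
        2 * κ * (4 * Real.pi ^ 2 * E τ - Torus.scalarGradNormSq (θ τ)) := by
      rw [hc]; ring
    rw [e1]
    exact mul_nonpos_iff.2 (Or.inl ⟨by positivity, by linarith [hP τ hτ]⟩)
  have hanti : AntitoneOn (fun σ => Real.exp (c * σ) * E σ) S' :=
    antitoneOn_of_hasDerivWithinAt_nonpos hS' (fun τ hτ => (hdg τ hτ).continuousWithinAt)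
      (fun τ hτ => (hdg τ (interior_subset hτ)).mono interior_subset)
      (fun τ hτ => hg0 τ (interior_subset hτ))
  have h3 : Real.exp (c * t) * E t ≤ Real.exp (c * s) * E s := hanti hsS' htS' hst
  have h4 : E t ≤ Real.exp (c * s) * E s / Real.exp (c * t) :=
    (le_div_iff₀' (Real.exp_pos _)).2 h3
  calc E t ≤ Real.exp (c * s) * E s / Real.exp (c * t) := h4
    _ = Real.exp (c * s - c * t) * E s := by rw [Real.exp_sub]; ring
    _ = Real.exp (-c * (t - s)) * E s := by congr 1; congr 1; ring

/-- **P1 `stub_fixedViscosityEnvelope` (line `Sketch` = duhamel-release, crux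
`TwoAndHalfD.TwohalfdThesis`): the fixed-diffusivity exponential envelope.** For `κ > 0`, a smooth
zero-mean pattern `h` on `𝕋²` and a classical solution `φ` of `∂ₜφ + u·∇φ = κΔφ`, `div u = 0`, on
`[s, ∞)` released from `φ(s) = h`, one has `‖φ(t)‖²_{L²} ≤ e^{-8π²κ(t-s)} ‖h‖²_{L²}` for all
`t ≥ s` (mean conservation, the `L²` balance, Poincaré–Wirtinger with the sharp constant `4π²`
of the unit torus, Gronwall: `scalarL2Sq_le_exp_mul_of_hasZeroMean` on the convex set `[s, ∞)`).
At fixed `κ` every release thus has the integrable envelope `Λ(τ)² = e^{-8π²κτ}`; the line's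
witness asks for such an envelope uniformly as `κ = ν_j → 0`. [folklore] -/
theorem stub_fixedViscosityEnvelope : ∀ (κ s : ℝ) (u : ℝ → (UnitAddTorus (Fin 2)) → (EuclideanSpace ℝ (Fin 2))) (h : (UnitAddTorus (Fin 2)) → ℝ) (φ : ℝ → (UnitAddTorus (Fin 2)) → ℝ), 0 < κ → Torus.IsSmooth h → Torus.HasZeroMean h → Torus.IsClassicalScalarTransportOn (Ici s) κ u φ → φ s = h → ∀ t, s ≤ t → Torus.scalarL2Sq (φ t) ≤ Real.exp (-(8 * Real.pi ^ 2 * κ) * (t - s)) * Torus.scalarL2Sq h := by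
  intro κ s u h φ hκ _ h0 hsol hφs t hst
  subst hφs
  exact scalarL2Sq_le_exp_mul_of_hasZeroMean hsol hκ.le (convex_Ici s) self_mem_Ici hst hst h0

end Summit.AnomalousDissipation.AnomalousDissipation.Theorems.TwohalfdThesis

end
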